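import Literature.MathematicalPhysics.QuantumFieldTheory.Balaban1983to89.Node00.OpsYRecordV11SH

/-!
# BalabanUVNodes ∕ N06 ([B9], `Dag.B9_main`) — ROW 26's TWO READING PINS AT A PINNED LETTER RECORD: the certificate's (3.132) display currency
# `siteKernelR R₁ R₂ ((opsYSectESt … 𝔏 …) x).QGQinv ∕ .QG1Qinv` EQUALS the knit reader's `siteKernelOfOpNu … (Ring.inverse (QGQOfQY … (𝔏 x).GD ∕ (𝔏 x).G₁ …))`
# under the letter pins `h𝔏QGQ h𝔏QG1Q h𝔏GD h𝔏G1` (node00-def-Y: `rfl` at the knit record; here at a GENERIC `𝔏`) — the conversion «KD‴» uses to DERIVE `s3132K` inside the network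

Track A of `YM-PLAN.md` (cell `pub-ymgap`, HUMAN RULING D-0062), node **N06** = [Balaban1985BackgroundPropagators] Thms 3.1–3.15; seat `pub-ymgap-dag-n06-d` (s2), gen 27.
WHAT.  The knit Sect.-D network («KD″» ✓p800210) still DISPLAYS row 26 `s3132K : B9.Stmt3132Printed … (fun x => siteKernelR R₁ R₂ ((opsYSectESt … 𝔏 …) x).QGQinv)
(fun x => siteKernelR R₁ R₂ (… x).QG1Qinv)` because the knit reader ✓`N06Eq3132FromStateKnitQ.s3132_nu_knit_of_stepS_R` (dag-n06-l) concludes in the currency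
`(fun x => siteKernelOfOpNu x.toKIdx (bg9YR …) (fun U => U) (nuY (d+1) x.toKIdx) (fun U => Ring.inverse (QGQOfQY x.toKIdx (𝔮 x) (𝔮s x) (T x) U)))`.  node00-def-Y (bus 2026-08-31
00:34Z) kernel-checked that the two agree by `rfl` AT THE RECORD `𝔏 := lettersYOfRecordV11K …`; at a GENERIC letter record `𝔏` carrying the certificate's pins
`h𝔏QGQ : (𝔏 x).QGQinv = QGQinvQY …`, `h𝔏GD : (𝔏 x).GD = GDQY …` (resp. `h𝔏QG1Q`, `h𝔏G1`) they agree after ONE rewrite each: ★ `siteKernelR_QGQinv_eq_nu_of_pins`,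
★ `siteKernelR_QG1Qinv_eq_nu_of_pins` (∀-x forms, usable by `simp only` under the `fun x =>` binder of `B9.Stmt3132Printed`).  The δ-chain: `(opsYSectESt … x).QGQinv`
unfolds to `siteKernelOfOpNu … (bg9Y …) … (𝔏 x).QGQinv` (star layer ∕ H-layer ∕ n06-i's `operatorLayerYS349Nu`), `siteKernelR R₁ R₂ ⟨k⟩ = ⟨k⟩`, and `QGQinvQY i 𝔮 𝔮s p G U`
unfolds to `Ring.inverse (QGQOfQY i 𝔮 𝔮s (GDQY i 𝔮 𝔮s p G) U)` (`Node00.OpsYSectDQ`), `QG1QinvQY … Δ2 = QGQinvOfQY … (G1QY … Δ2)` likewise.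
HONEST FRAMING.  Kernel bookkeeping (two `rw` + `rfl`); nothing of [B9] asserted; COUNT-NEUTRAL; N06 NOT discharged; nothing continuum ∕ OS ∕ Clay.  0 `def`, 0 `sorry`.  NEW file.
RELATED, NOT DUPLICATED (searched 2026-08-31: `rg -l -w "N06Row26ReadingPinsAtLetters|siteKernelR_QGQinv_eq_nu_of_pins|siteKernelR_QG1Qinv_eq_nu_of_pins"` = ∅): n06-i's straight
✓`B9Eq3132NuReadingR.siteKernelR_opsYNuOfRecordV4E_QGQinv ∕ _QG1Qinv` (`rfl` at the v4 record).
-/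

noncomputable section

namespace Summit.QuantumFields.YangMills.BalabanUVNodes.N06Row26ReadingPinsAtLetters

open Literature.MathematicalPhysics.QuantumFieldTheory.Balaban1983to89
open Literature.MathematicalPhysics.QuantumFieldTheory.Balaban1983to89.Node00
open Literature.MathematicalPhysics.QuantumFieldTheory.Balaban1983to89.B9PinMembersKLevelV1 (MemberY geo9Y bg9Y)
open Literature.MathematicalPhysics.QuantumFieldTheory.Balaban1983to89.B9BackgroundsKLevelV1R (RegFamY bg9YR siteKernelR)
open Literature.MathematicalPhysics.QuantumFieldTheory.Balaban1983to89.B7Prop2SpecialUnitary (specialUnitaryUnits)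
open Literature.MathematicalPhysics.QuantumFieldTheory.Balaban1983to89.B9Eq3132NuReading (nuY siteKernelOfOpNu)
open Literature.MathematicalPhysics.QuantumFieldTheory.Balaban1983to89.B9B8AveragingJunction (parKnitY)
open Literature.MathematicalPhysics.QuantumFieldTheory.Balaban1983to89.Node00.OpsYQLetter (qKnitOfRecord qsKnitOfRecord)
open scoped Matrix.Norms.L2Operator

variable {N : ℕ} [Nonempty (Fin N)] (θ : Stage3Params) (Mstar : ℕ) (𝔏 : LettersY N θ Mstar)
  (parH : ∀ x : MemberY θ.d₆ θ.ℓ₆ θ.hd' θ.hL' θ.b₀ θ.b₁ Mstar, SiteParY (Matrix (Fin N) (Fin N) ℂ) x.toKIdx)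
  (𝔈 : ExpsY N θ Mstar) (𝔢 : SectEStY N θ Mstar) (𝔴 : RWEY N θ Mstar) (𝔯 : ResY N θ Mstar)
  (R₁ R₂ : RegFamY θ.d₆ θ.ℓ₆ θ.hd' θ.hL' θ.b₀ θ.b₁ Mstar (Matrix (Fin N) (Fin N) ℂ))

/-- ★ **ROW 26's FIRST READING PIN AT A PINNED LETTER RECORD**: under `h𝔏QGQ` and `h𝔏GD`, for every member
`siteKernelR R₁ R₂ ((opsYSectESt … 𝔏 …) x).QGQinv = siteKernelOfOpNu … (fun U => Ring.inverse (QGQOfQY x (qKnit) (qsKnit) ((𝔏 x).GD) U))`.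
[cite: Balaban1985BackgroundPropagators, (3.132) p.422, (3.123) p.420, (3.115) p.418 (bookkeeping)] -/
theorem siteKernelR_QGQinv_eq_nu_of_pins
    (h𝔏QGQ : ∀ x : MemberY θ.d₆ θ.ℓ₆ θ.hd' θ.hL' θ.b₀ θ.b₁ Mstar, (𝔏 x).QGQinv = QGQinvQY x.toKIdx (qKnitOfRecord N θ x.toKIdx) (qsKnitOfRecord N θ x.toKIdx) (parKnitY x.toKIdx) (GpPhysY x.toKIdx (parKnitY x.toKIdx)))
    (h𝔏GD : ∀ x : MemberY θ.d₆ θ.ℓ₆ θ.hd' θ.hL' θ.b₀ θ.b₁ Mstar, (𝔏 x).GD = GDQY x.toKIdx (qKnitOfRecord N θ x.toKIdx) (qsKnitOfRecord N θ x.toKIdx) (parKnitY x.toKIdx) (GpPhysY x.toKIdx (parKnitY x.toKIdx)))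
    (x : MemberY θ.d₆ θ.ℓ₆ θ.hd' θ.hL' θ.b₀ θ.b₁ Mstar) :
    siteKernelR R₁ R₂ ((opsYSectESt N θ Mstar (opsYS349NuOfLettersH N θ Mstar 𝔏 parH 𝔈) 𝔏 𝔢 𝔴) x).QGQinv =
      siteKernelOfOpNu x.toKIdx (bg9YR (Matrix (Fin N) (Fin N) ℂ) (specialUnitaryUnits (Fin N)) R₁ R₂ x) (fun U => U) (nuY (θ.d₆ + 1) x.toKIdx)
        (fun U => Ring.inverse (QGQOfQY x.toKIdx (qKnitOfRecord N θ x.toKIdx) (qsKnitOfRecord N θ x.toKIdx) ((𝔏 x).GD) U)) := by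
  have E0 : siteKernelR R₁ R₂ ((opsYSectESt N θ Mstar (opsYS349NuOfLettersH N θ Mstar 𝔏 parH 𝔈) 𝔏 𝔢 𝔴) x).QGQinv =
      siteKernelOfOpNu x.toKIdx (bg9YR (Matrix (Fin N) (Fin N) ℂ) (specialUnitaryUnits (Fin N)) R₁ R₂ x) (fun U => U) (nuY (θ.d₆ + 1) x.toKIdx) (𝔏 x).QGQinv := rfl
  rw [E0, h𝔏QGQ x, h𝔏GD x]; rfl

/-- ★ **ROW 26's SECOND READING PIN AT A PINNED LETTER RECORD**: under `h𝔏QG1Q` and `h𝔏G1`, for every member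
`siteKernelR R₁ R₂ ((opsYSectESt … 𝔏 …) x).QG1Qinv = siteKernelOfOpNu … (fun U => Ring.inverse (QGQOfQY x (qKnit) (qsKnit) ((𝔏 x).G₁) U))`.
[cite: Balaban1985BackgroundPropagators, (3.132) p.422, (3.128) p.421, (3.134) p.422 (bookkeeping)] -/
theorem siteKernelR_QG1Qinv_eq_nu_of_pins
    (h𝔏QG1Q : ∀ x : MemberY θ.d₆ θ.ℓ₆ θ.hd' θ.hL' θ.b₀ θ.b₁ Mstar, (𝔏 x).QG1Qinv = QG1QinvQY x.toKIdx (qKnitOfRecord N θ x.toKIdx) (qsKnitOfRecord N θ x.toKIdx) (parKnitY x.toKIdx) (GpPhysY x.toKIdx (parKnitY x.toKIdx)) ((𝔯 x).Δ2))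
    (h𝔏G1 : ∀ x : MemberY θ.d₆ θ.ℓ₆ θ.hd' θ.hL' θ.b₀ θ.b₁ Mstar, (𝔏 x).G₁ = G1QY x.toKIdx (qKnitOfRecord N θ x.toKIdx) (qsKnitOfRecord N θ x.toKIdx) (parKnitY x.toKIdx) (GpPhysY x.toKIdx (parKnitY x.toKIdx)) ((𝔯 x).Δ2))
    (x : MemberY θ.d₆ θ.ℓ₆ θ.hd' θ.hL' θ.b₀ θ.b₁ Mstar) :
    siteKernelR R₁ R₂ ((opsYSectESt N θ Mstar (opsYS349NuOfLettersH N θ Mstar 𝔏 parH 𝔈) 𝔏 𝔢 𝔴) x).QG1Qinv =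
      siteKernelOfOpNu x.toKIdx (bg9YR (Matrix (Fin N) (Fin N) ℂ) (specialUnitaryUnits (Fin N)) R₁ R₂ x) (fun U => U) (nuY (θ.d₆ + 1) x.toKIdx)
        (fun U => Ring.inverse (QGQOfQY x.toKIdx (qKnitOfRecord N θ x.toKIdx) (qsKnitOfRecord N θ x.toKIdx) ((𝔏 x).G₁) U)) := by
  have E0 : siteKernelR R₁ R₂ ((opsYSectESt N θ Mstar (opsYS349NuOfLettersH N θ Mstar 𝔏 parH 𝔈) 𝔏 𝔢 𝔴) x).QG1Qinv =
      siteKernelOfOpNu x.toKIdx (bg9YR (Matrix (Fin N) (Fin N) ℂ) (specialUnitaryUnits (Fin N)) R₁ R₂ x) (fun U => U) (nuY (θ.d₆ + 1) x.toKIdx) (𝔏 x).QG1Qinv := rfl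
  rw [E0, h𝔏QG1Q x, h𝔏G1 x]; rfl

end Summit.QuantumFields.YangMills.BalabanUVNodes.N06Row26ReadingPinsAtLetters

end
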